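import Literature.NumberTheory.Sieve.FGKMT2018MultidimensionalSieve
import HarnessLib

/-!
# FGKMT 2018 (7.9) / Maynard 2016 §9: expanding the sieve weight —
`∑_n g(n) w(n) = ∑_{d,e ∈ 𝒟_k} λ_d λ_e ∑_{n : (L_i(n),W)=1, d_i, e_i ∣ L_i(n)} g(n)`

Source: K. Ford, B. Green, S. Konyagin, J. Maynard, T. Tao, *Long gaps between primes*, J. Amer.
Math. Soc. 31 (2018), (7.9) p. 21 [FordGreenKonyaginMaynardTao2018]; J. Maynard, *Dense clusters of
primes in subsets*, Compositio Math. 152 (2016), §9, first display of the proofs of Propositions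
9.1 and 9.2 p. 19–20 («we expand out the square and swap the order of summation»)
[Maynard2016DenseClusters].

The first step of every estimate for the weights
`w(n) = 1_{(L_i(n), W) = 1 ∀ i} (∑_{d ∈ 𝒟_k, d_i ∣ L_i(n)} λ_d)²` (`sieveWt`, with `𝒟_k = dkBox L B R`
and `λ_d = lamVar L B R F d`): expand the square and swap the sums (theorems only):

* `sieveWt_eq_sum_sum` — pointwise:
  `w(n) = ∑_{d ∈ 𝒟_k} ∑_{e ∈ 𝒟_k} 1[(L_i(n),W)=1 ∀ i ∧ d_i ∣ L_i(n) ∀ i ∧ e_i ∣ L_i(n) ∀ i] λ_d λ_e`;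
* `sum_mul_sieveWt_eq` — for any finite `S ⊆ ℤ` and any `g`:
  `∑_{n ∈ S} g(n) w(n) = ∑_{d} ∑_{e} λ_d λ_e ∑_{n ∈ S : (L_i(n),W)=1, d_i ∣ L_i(n), e_i ∣ L_i(n)} g(n)`
  (the shape used for (7.13)–(7.14) with `g` a prime indicator);
* `sum_sieveWt_eq` — `g = 1`:
  `∑_{n ∈ S} w(n) = ∑_{d} ∑_{e} λ_d λ_e · #{n ∈ S : (L_i(n),W)=1, d_i ∣ L_i(n), e_i ∣ L_i(n) ∀ i}`
  (the shape used for (7.12)).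

## References
* [FordGreenKonyaginMaynardTao2018] (7.9) p. 21.
* [Maynard2016DenseClusters] §9 pp. 19–20 (proofs of Propositions 9.1, 9.2: first display).
-/

noncomputable section

open Finset

namespace Literature.NumberTheory.Sieve.FGKMT2018

variable {k : ℕ}

/-- **Expanding the square, pointwise**:
`w(n) = ∑_{d ∈ 𝒟_k} ∑_{e ∈ 𝒟_k} 1[(L_i(n),W)=1 ∀ i, d_i ∣ L_i(n) ∀ i, e_i ∣ L_i(n) ∀ i] · λ_d λ_e`.
[cite: FordGreenKonyaginMaynardTao2018, (7.9) p. 21; Maynard2016DenseClusters, §9 p. 19] -/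
theorem sieveWt_eq_sum_sum (L : Fin k → ℤ × ℤ) (B : ℕ) (R : ℝ) (F : (Fin k → ℝ) → ℝ) (n : ℤ) :
    sieveWt L B R F n = ∑ d ∈ dkBox L B R, ∑ e ∈ dkBox L B R,
      (if (∀ i, Int.gcd (formEval (L i) n) (wCut k B) = 1) ∧
          (∀ i, ((d i : ℕ) : ℤ) ∣ formEval (L i) n) ∧ (∀ i, ((e i : ℕ) : ℤ) ∣ formEval (L i) n)
        then lamVar L B R F d * lamVar L B R F e else 0) := by
  classical
  unfold sieveWt
  split_ifs with hc
  · rw [sq, Finset.sum_filter, Finset.sum_mul_sum]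
    refine Finset.sum_congr rfl fun d _ => Finset.sum_congr rfl fun e _ => ?_
    by_cases hd : (∀ i, ((d i : ℕ) : ℤ) ∣ formEval (L i) n) <;>
      by_cases he : (∀ i, ((e i : ℕ) : ℤ) ∣ formEval (L i) n) <;> simp [hc, hd, he]
  · symm
    refine Finset.sum_eq_zero fun d _ => Finset.sum_eq_zero fun e _ => ?_
    rw [if_neg (fun h => hc h.1)]

/-- **Expanding the square and swapping the sums** (any finite set `S` of integers, any weight `g`):
`∑_{n ∈ S} g(n) w(n) = ∑_{d ∈ 𝒟_k} ∑_{e ∈ 𝒟_k} λ_d λ_e ∑_{n ∈ S : (L_i(n),W)=1, d_i ∣ L_i(n), e_i ∣ L_i(n) ∀ i} g(n)`.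
[cite: FordGreenKonyaginMaynardTao2018, (7.9), (7.12)–(7.14) pp. 21–22; Maynard2016DenseClusters, §9 pp. 19–20] -/
theorem sum_mul_sieveWt_eq (L : Fin k → ℤ × ℤ) (B : ℕ) (R : ℝ) (F : (Fin k → ℝ) → ℝ)
    (S : Finset ℤ) (g : ℤ → ℝ) :
    ∑ n ∈ S, g n * sieveWt L B R F n = ∑ d ∈ dkBox L B R, ∑ e ∈ dkBox L B R,
      lamVar L B R F d * lamVar L B R F e *
        ∑ n ∈ S.filter (fun n => (∀ i, Int.gcd (formEval (L i) n) (wCut k B) = 1) ∧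
            (∀ i, ((d i : ℕ) : ℤ) ∣ formEval (L i) n) ∧ ∀ i, ((e i : ℕ) : ℤ) ∣ formEval (L i) n),
          g n := by
  classical
  simp_rw [sieveWt_eq_sum_sum, Finset.mul_sum]
  rw [Finset.sum_comm]
  refine Finset.sum_congr rfl fun d _ => ?_
  rw [Finset.sum_comm]
  refine Finset.sum_congr rfl fun e _ => ?_
  rw [Finset.sum_filter]
  refine Finset.sum_congr rfl fun n _ => ?_
  split_ifs <;> ring

/-- **`∑_{n ∈ S} w(n) = ∑_{d, e ∈ 𝒟_k} λ_d λ_e · #{n ∈ S : (L_i(n),W)=1, d_i ∣ L_i(n), e_i ∣ L_i(n) ∀ i}`**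
(the case `g = 1`, first display of the proof of [Maynard2016DenseClusters, Prop. 9.1]).
[cite: FordGreenKonyaginMaynardTao2018, (7.9), (7.12) p. 21; Maynard2016DenseClusters, §9 p. 19] -/
theorem sum_sieveWt_eq (L : Fin k → ℤ × ℤ) (B : ℕ) (R : ℝ) (F : (Fin k → ℝ) → ℝ) (S : Finset ℤ) :
    ∑ n ∈ S, sieveWt L B R F n = ∑ d ∈ dkBox L B R, ∑ e ∈ dkBox L B R,
      lamVar L B R F d * lamVar L B R F e *
        #(S.filter (fun n => (∀ i, Int.gcd (formEval (L i) n) (wCut k B) = 1) ∧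
            (∀ i, ((d i : ℕ) : ℤ) ∣ formEval (L i) n) ∧ ∀ i, ((e i : ℕ) : ℤ) ∣ formEval (L i) n)) := by
  have h := sum_mul_sieveWt_eq L B R F S (fun _ => (1 : ℝ))
  simp only [one_mul, Finset.sum_const, nsmul_eq_mul, mul_one] at h
  exact h

end Literature.NumberTheory.Sieve.FGKMT2018
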